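import Mathlib
import Summits.AtomisticToContinuum.FouriersLaw.Theorems.ContactStieltjesMeasureContactMeasureLimitStubTruncatedConvergence
import Summits.AtomisticToContinuum.FouriersLaw.Theorems.ContactStieltjesMeasureContactMeasureLimitStubLayerCake
import Summits.AtomisticToContinuum.FouriersLaw.Theorems.ContactStieltjesMeasureContactMeasureLimitStubEscapedMassConstant

/-!
# One-friction a priori bound for contact distribution functions
# (glue for crux `ContactMeasureLimit`, line `IdeatorOneSketch`)

Crux `ContactStieltjesMeasure.ContactMeasureLimit` (stmt-AtomisticToContinuum-15250), line `IdeatorOneSketch`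
(idea `escaped-mass-stieltjes-constant`). For a contact distribution function `F` (monotone, zero on `(-∞,0]`,
bounded) and the contact kernel `k_γ(t) = 2t/(γ²+t²)²` (`∫_t^∞ k_γ = (γ²+t²)⁻¹`, landed in `…StubLayerCake`):

* `apriori_local_bound`: `F(t) ≤ (γ² + t²)·∫₀^∞ F k_γ` — pointwise control of `F` from the value of its transform
  at ONE friction (what makes Helly's selection available without any `N`-uniform hypothesis);
* `apriori_pointwise_bound_of_tendsto`: a family whose transforms at `γ = 1` converge is bounded at each point
  uniformly in `N`.
-/

noncomputable section

namespace Summit.AtomisticToContinuum.FouriersLaw.Theorems.ContactMeasureLimit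

open MeasureTheory Filter Set Topology

/-- **A priori local bound from ONE friction**: `F(t) ≤ (γ² + t²)·∫₀^∞ F k_γ` for a bounded contact distribution
function `F` and `t > 0` (since `F(t)·(γ²+t²)⁻¹ = ∫_t^∞ F(t) k_γ ≤ ∫_t^∞ F k_γ ≤ ∫₀^∞ F k_γ`). [folklore] -/
theorem apriori_local_bound {F : ℝ → ℝ}
    (hF : Monotone F ∧ (∀ s : ℝ, s ≤ 0 → F s = 0) ∧ ∃ m : ℝ, ∀ s : ℝ, F s ≤ m) {γ : ℝ} (hγ : 0 < γ)
    {t : ℝ} (ht : 0 < t) :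
    F t ≤ (γ ^ 2 + t ^ 2) * ∫ s in Ioi (0 : ℝ), F s * (2 * s / (γ ^ 2 + s ^ 2) ^ 2) := by
  have hmono := hF.1
  have hF0 : ∀ s, 0 ≤ s → 0 ≤ F s := fun s hs => escaped_nonneg_of_monotone hF.1 hF.2.1 hs
  obtain ⟨hkint, hkval⟩ := layerCake_integral_Ioi_kernel hγ ht.le
  have hpos : 0 < γ ^ 2 + t ^ 2 := by positivity
  have h1 : F t * (γ ^ 2 + t ^ 2)⁻¹ = ∫ s in Ioi t, F t * (2 * s / (γ ^ 2 + s ^ 2) ^ 2) := by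
    rw [integral_const_mul, hkval]
  have h2 : ∫ s in Ioi t, F t * (2 * s / (γ ^ 2 + s ^ 2) ^ 2) ≤
      ∫ s in Ioi t, F s * (2 * s / (γ ^ 2 + s ^ 2) ^ 2) := by
    refine setIntegral_mono_on (hkint.const_mul (F t)) (escaped_integrableOn_mul_kernel hF hγ ht.le)
      measurableSet_Ioi (fun s hs => ?_)
    exact mul_le_mul_of_nonneg_right (hmono (le_of_lt hs))
      (truncated_kernel_nonneg γ (ht.le.trans (le_of_lt hs)))
  have h3 : ∫ s in Ioi t, F s * (2 * s / (γ ^ 2 + s ^ 2) ^ 2) ≤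
      ∫ s in Ioi (0 : ℝ), F s * (2 * s / (γ ^ 2 + s ^ 2) ^ 2) := by
    refine setIntegral_mono_set (escaped_integrableOn_mul_kernel hF hγ le_rfl) ?_ ?_
    · rw [EventuallyLE, ae_restrict_iff' measurableSet_Ioi]
      exact ae_of_all _ (fun s hs =>
        mul_nonneg (hF0 s (le_of_lt hs)) (truncated_kernel_nonneg γ (le_of_lt hs)))
    · exact ae_of_all _ (Ioi_subset_Ioi ht.le)
  have key : F t * (γ ^ 2 + t ^ 2)⁻¹ ≤ ∫ s in Ioi (0 : ℝ), F s * (2 * s / (γ ^ 2 + s ^ 2) ^ 2) :=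
    h1.le.trans (h2.trans h3)
  have := mul_le_mul_of_nonneg_left key hpos.le
  rw [mul_comm (F t), ← mul_assoc, mul_inv_cancel₀ hpos.ne', one_mul] at this
  exact this

/-- Pointwise bounds, uniform in `N`, for a family of bounded contact distribution functions whose contact
transforms at friction `γ = 1` converge. [folklore] -/
theorem apriori_pointwise_bound_of_tendsto :
    ∀ F : ℕ → ℝ → ℝ,
      (∀ N : ℕ, Monotone (F N) ∧ (∀ s : ℝ, s ≤ 0 → F N s = 0) ∧ ∃ m : ℝ, ∀ s : ℝ, F N s ≤ m) →
      ∀ L₁ : ℝ, Filter.Tendsto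
        (fun N : ℕ => ∫ s in Set.Ioi (0 : ℝ), F N s * (2 * s / (1 ^ 2 + s ^ 2) ^ 2)) Filter.atTop (nhds L₁) →
      ∀ t : ℝ, ∃ C : ℝ, ∀ N : ℕ, F N t ≤ C := by
  intro F hF L₁ h₁ t
  obtain ⟨B, hB⟩ := h₁.bddAbove_range
  rcases le_or_gt t 0 with ht | ht
  · exact ⟨0, fun N => by rw [(hF N).2.1 t ht]⟩
  · refine ⟨(1 ^ 2 + t ^ 2) * B, fun N => ?_⟩
    calc F N t ≤ (1 ^ 2 + t ^ 2) * ∫ s in Ioi (0 : ℝ), F N s * (2 * s / (1 ^ 2 + s ^ 2) ^ 2) :=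
          apriori_local_bound (hF N) one_pos ht
      _ ≤ (1 ^ 2 + t ^ 2) * B :=
          mul_le_mul_of_nonneg_left (hB ⟨N, rfl⟩) (by positivity)

end Summit.AtomisticToContinuum.FouriersLaw.Theorems.ContactMeasureLimit

end
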